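import Literature.NumberTheory.Automorphic.ArchInnerFormPlaceNormalForm           -- ★ P2a: frame algebra, compact case (+ P1: `coe_gprimeSplitGL_eq_conj_diagonal`)
import Literature.NumberTheory.Rogawski1990.ArchDefinitePlaceNoSplitPartner       -- ★ L1: `norm_eq_one_of_isRoot_charpoly_of_mem_unitaryGroupOfForm_of_posDef`, `mem_unitaryGroupOfForm_neg_iff`
import HarnessLib

/-!
# Regular normal forms in `U(diag e)(ℂ)`, rank 3 — the split case: a non-unit eigenvalue forces the boost chart ((PARTNER) P2b = (EXH-G′) local, split case;
# Rogawski 1990 §3.1, §3.6; Knapp 1986 V §3; Horn–Johnson 1.3.9)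

Topic `NumberTheory/Automorphic`; namespace `Literature.NumberTheory.Automorphic.UnitaryGroup`.  THEOREMS ONLY (no `def`, no instance, no notation, no axiom, no
named fact, no `sorry`).  Cell `pub/hodgecm-mathlib`, crux H413 (`stmt-HodgeConjecture-24833`), F0∕P3c line LH3, DIRECT ROAD of `stub_N9`; seat LH3-p03 (g2); organ
(PARTNER) part P2 = (EXH-G′), LOCAL half, SPLIT case (sibling of ★ `ArchInnerFormPlaceNormalForm`).  Count-neutral.

THE MATHEMATICS.  `J = diag(e)` real, `e_i ≠ 0`; `γ ∈ U(J)(ℂ)` with separable `χ_γ` and an eigenvalue `d_{i₀}` with `|d_{i₀}| ≠ 1`.  Eigenframe `γ S = S diag(d)` (★ HJ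
1.3.9), Gram `Q = Sᴴ J S` (Hermitian, invertible), frame relation `(d̄_i d_j − 1) Q_ij = 0` (★ P2a).  Then `Q_{i₀i₀} = 0`; the row `i₀` of `Q` is non-zero, so some
`Q_{i₀j} = β ≠ 0` with `d̄_{i₀} d_j = 1` (`j ≠ i₀`, `|d_j| = |d_{i₀}|⁻¹ ≠ 1`, `Q_jj = 0`); for the third index `m`: `Q_{i₀m} = Q_{jm} = 0` (else `d_m ∈ {d_j, d_{i₀}}`),
hence `Q_mm = q ≠ 0`, `|d_m| = 1`; in the order `(i₀, m, j)`: `Q ≃ (0, 0, β; 0, q, 0; β̄, 0, 0)`, `det Q = −q|β|² = |det S|² e₀e₁e₂`.  The form is indefinite (a definite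
`U(J)` has unit spectrum, ★ `norm_eq_one_of_isRoot_charpoly_of_mem_unitaryGroupOfForm_of_posDef`), so with `τ = lineOf (sgn e)`: `e_{τ0} e_{τ2} < 0` (★
`mul_apply_lineOf_neg`) and `e_{τ1} q > 0`.  Rescale: `c_{i₀} = 1`, `c_m = √(e_{τ1}∕q)`, `c_j = −2e_{τ2}∕β`; then the frame `(v_{i₀}, c_m v_m, c_j v_j)` has the Gram matrix
`(0, 0, −2b₂; 0, b₁, 0; −2b₂, 0, 0) = (cayB b)ᴴ diag(b) (cayB b)` of the MODEL frame (`b = e ∘ τ`), and eigenvalues `(d_{i₀}, d_m, d_j) = boostEig (log |d_{i₀}|, arg d_m,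
arg d_{i₀})`; transporting the frame to the model frame (`frame_transport`: `k = V P̃⁻¹ ∈ U(J)`, `γ = k (P̃ D̃ P̃⁻¹) k⁻¹`) gives **`γ = k · gprimeSplitGL τ e c · k⁻¹`,
`c 0 = log |d_{i₀}| ≠ 0`** (`exists_unitary_conj_gprimeSplitGL`).
* §1 `frame_transport`, `conjTranspose_cayB_mul_diagonal_mul_cayB`, `det_frameGram`, `exists_third_index`, `exists_perm_apply_eq`;
* §2 **`exists_unitary_conj_gprimeSplitGL`**.
HONEST LABEL: HC_CM is proved only modulo the 7 printed citations (2 remaining: hLiu418 = `stmt-HodgeConjecture-24832`, h413 = `stmt-HodgeConjecture-24833`) until rung 0 closes (+0∕+0).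

## References
* [Rogawski1990] J. D. Rogawski, *Automorphic Representations of Unitary Groups in Three Variables*, Ann. of Math. Stud. 123 (1990), §3.1 p. 19, §3.6 p. 31.
* [Knapp1986] A. W. Knapp, *Representation Theory of Semisimple Groups* (1986), Ch. V §3 (the `MA` Cartan of `SU(2,1)`).
* [HornJohnson2013] R. A. Horn, C. R. Johnson, *Matrix Analysis*, 2nd ed. (2013), Thm. 1.3.9.
-/

set_option autoImplicit false

noncomputable section

open NumberField NumberField.InfinitePlace Matrix Complex Polynomial
open scoped MatrixGroups Matrix ComplexConjugate Real Classical ComplexOrder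

namespace Literature.NumberTheory.Automorphic.UnitaryGroup

open Literature.NumberTheory.Rogawski1990

/-! ## §1 Frame transport and the model Gram matrix -/

section Frame

variable {n : Type*} [Fintype n] [DecidableEq n]

/-- **Frame transport**: if `γ V = V D`, `Y = P D P⁻¹` and the frames `V`, `P` have the same Gram matrix for `J`, then `k = V P⁻¹` preserves `J` and `γ = k Y k⁻¹`.
[cite: HornJohnson2013, Thm 1.3.9] [cite: Rogawski1990, §3.1 p. 19] -/
theorem frame_transport {γ Y V P D J : Matrix n n ℂ} (hV : IsUnit V.det) (hP : IsUnit P.det) (hγV : γ * V = V * D) (hY : Y = P * D * P⁻¹)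
    (hGram : Vᴴ * J * V = Pᴴ * J * P) :
    (V * P⁻¹)ᴴ * J * (V * P⁻¹) = J ∧ γ = V * P⁻¹ * Y * (V * P⁻¹)⁻¹ := by
  constructor
  · calc (V * P⁻¹)ᴴ * J * (V * P⁻¹) = P⁻¹ᴴ * (Vᴴ * J * V) * P⁻¹ := by rw [Matrix.conjTranspose_mul V P⁻¹]; simp only [Matrix.mul_assoc]
      _ = P⁻¹ᴴ * (Pᴴ * J * P) * P⁻¹ := by rw [hGram]
      _ = (P * P⁻¹)ᴴ * J * (P * P⁻¹) := by rw [Matrix.conjTranspose_mul P P⁻¹]; simp only [Matrix.mul_assoc]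
      _ = J := by rw [Matrix.mul_nonsing_inv _ hP, Matrix.conjTranspose_one, Matrix.one_mul, Matrix.mul_one]
  · rw [Matrix.mul_inv_rev, Matrix.nonsing_inv_nonsing_inv _ hP, hY]
    calc γ = γ * V * V⁻¹ := by rw [Matrix.mul_nonsing_inv_cancel_right _ _ hV]
      _ = V * D * V⁻¹ := by rw [hγV]
      _ = V * P⁻¹ * (P * D * P⁻¹) * (P * V⁻¹) := by
          simp only [Matrix.mul_assoc]
          rw [Matrix.nonsing_inv_mul_cancel_left _ _ hP, Matrix.nonsing_inv_mul_cancel_left _ _ hP]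

/-- `det (Sᴴ diag(e) S) = |det S|² ∏ e_i` (real). [cite: HornJohnson2013, Thm 4.5.8] -/
theorem det_frameGram (S : Matrix n n ℂ) (e : n → ℝ) :
    (Sᴴ * Matrix.diagonal (fun i => (e i : ℂ)) * S).det = ((‖S.det‖ ^ 2 * ∏ i, e i : ℝ) : ℂ) := by
  rw [Matrix.det_mul, Matrix.det_mul, Matrix.det_conjTranspose, Matrix.det_diagonal, Complex.ofReal_mul, Complex.ofReal_pow, Complex.ofReal_prod,
    ← Complex.conj_mul', Complex.star_def]
  ring

/-- **The model Gram matrix**: `(cayB b)ᴴ · diag(b) · cayB b = (0, 0, −2b₂; 0, b₁, 0; −2b₂, 0, 0)` for `b₀ b₂ < 0` (the columns `(r, 0, ±1)` are isotropic, `r² b₀ = −b₂`).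
[cite: Knapp1986, Ch. V §3] -/
theorem conjTranspose_cayB_mul_diagonal_mul_cayB {b : Fin 3 → ℝ} (hb : b 0 * b 2 < 0) :
    (cayB b)ᴴ * Matrix.diagonal (fun i => (b i : ℂ)) * cayB b = !![0, 0, -2 * (b 2 : ℂ); 0, (b 1 : ℂ), 0; -2 * (b 2 : ℂ), 0, 0] := by
  have hb0 : b 0 ≠ 0 := fun h => by rw [h, zero_mul] at hb; exact lt_irrefl _ hb
  have hr : ((Real.sqrt (-b 2 / b 0) : ℝ) : ℂ) ^ 2 * (b 0 : ℂ) = -(b 2 : ℂ) := by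
    have hq : 0 ≤ -b 2 / b 0 := by
      rcases lt_or_gt_of_ne hb0 with h | h
      · have : 0 < b 2 := by nlinarith
        exact le_of_lt (div_pos_of_neg_of_neg (by linarith) h)
      · have : b 2 < 0 := by nlinarith
        exact le_of_lt (div_pos (by linarith) h)
    have h : (Real.sqrt (-b 2 / b 0)) ^ 2 * b 0 = -b 2 := by rw [Real.sq_sqrt hq]; field_simp
    exact_mod_cast h
  ext i j
  fin_cases i <;> fin_cases j <;>
    simp [cayB, Matrix.mul_apply, Fin.sum_univ_three, Matrix.conjTranspose_apply, Matrix.diagonal_apply] <;>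
    linear_combination hr

/-- In `Fin 3`, two distinct indices leave exactly one third index. [folklore] -/
private theorem exists_third_index (i j : Fin 3) (h : i ≠ j) : ∃ m : Fin 3, m ≠ i ∧ m ≠ j ∧ ∀ x : Fin 3, x = i ∨ x = j ∨ x = m := by
  revert i j; decide

/-- In `Fin 3`, three distinct indices are the values of a permutation at `0, 1, 2`. [folklore] -/
private theorem exists_perm_apply_eq (i m j : Fin 3) (h1 : i ≠ m) (h2 : i ≠ j) (h3 : m ≠ j) :
    ∃ ψ : Equiv.Perm (Fin 3), ψ 0 = i ∧ ψ 1 = m ∧ ψ 2 = j := by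
  revert i m j; decide

end Frame

/-! ## §2 The split case: a non-unit eigenvalue -/

section Split

/-- **SPLIT NORMAL FORM IN `U(diag e)(ℂ)`, RANK 3.**  A regular semisimple `γ ∈ U(diag e)(ℂ)` (`e` real, `e_i ≠ 0`) with an eigenvalue off the unit circle is
`U(diag e)`-conjugate to a boost chart element `gprimeSplitGL (lineOf s) e c` with `x = c 0 ≠ 0` (`s = sgn e`); the form is then indefinite and the boost plane
`(lineOf s 0, lineOf s 2)` hyperbolic. [cite: Rogawski1990, §3.1 p. 19; §3.6 p. 31] [cite: Knapp1986, Ch. V §3] [cite: HornJohnson2013, Thm 1.3.9] -/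
theorem exists_unitary_conj_gprimeSplitGL {e : Fin 3 → ℝ} (he : ∀ i, e i ≠ 0) {γ : GL (Fin 3) ℂ}
    (hγ : γ ∈ unitaryGroupOfForm (starRingEnd ℂ) (Matrix.diagonal fun i => (e i : ℂ)))
    (hsep : ((γ : Matrix (Fin 3) (Fin 3) ℂ)).charpoly.Separable)
    (hnon : ∃ z : ℂ, ((γ : Matrix (Fin 3) (Fin 3) ℂ)).charpoly.IsRoot z ∧ ‖z‖ ≠ 1) :
    e (lineOf (fun i => SignType.sign (e i)) 0) * e (lineOf (fun i => SignType.sign (e i)) 2) < 0 ∧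
    ∃ k : GL (Fin 3) ℂ, k ∈ unitaryGroupOfForm (starRingEnd ℂ) (Matrix.diagonal fun i => (e i : ℂ)) ∧
      ∃ c : Fin 3 → ℝ, c 0 ≠ 0 ∧ γ = k * gprimeSplitGL (lineOf fun i => SignType.sign (e i)) e c * k⁻¹ := by
  set τ : Equiv.Perm (Fin 3) := lineOf (fun i => SignType.sign (e i)) with hτ
  set J : Matrix (Fin 3) (Fin 3) ℂ := Matrix.diagonal fun i => (e i : ℂ) with hJ
  set G : Matrix (Fin 3) (Fin 3) ℂ := (γ : Matrix (Fin 3) (Fin 3) ℂ) with hG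
  have hU : Gᴴ * J * G = J := by
    have h := mem_unitaryGroupOfForm_iff.1 hγ
    rwa [transpose_map_starRingEnd_complex] at h
  -- indefiniteness of the form: a definite `U(J)` has unit spectrum
  obtain ⟨z, hz, hz1⟩ := hnon
  have hind : ¬ (SignType.sign (e 0) = SignType.sign (e 1) ∧ SignType.sign (e 1) = SignType.sign (e 2)) := by
    rintro ⟨h01, h12⟩
    rcases lt_or_gt_of_ne (he 0) with h0 | h0
    · -- all negative: `-J` positive definite
      have hall : ∀ i, e i < 0 := by
        intro i; fin_cases i
        · exact h0
        · exact sign_eq_neg_one_iff.1 (h01 ▸ sign_eq_neg_one_iff.2 h0)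
        · exact sign_eq_neg_one_iff.1 (h12 ▸ h01 ▸ sign_eq_neg_one_iff.2 h0)
      have hpd : (-J).PosDef := by
        rw [hJ, Matrix.diagonal_neg]
        refine Matrix.posDef_diagonal_iff.2 fun i => ?_
        show (0 : ℂ) < -((e i : ℝ) : ℂ)
        rw [← Complex.ofReal_neg]
        exact Complex.zero_lt_real.2 (by linarith [hall i])
      exact hz1 (norm_eq_one_of_isRoot_charpoly_of_mem_unitaryGroupOfForm_of_posDef hpd (mem_unitaryGroupOfForm_neg_iff.2 hγ) hz)
    · -- all positive: `J` positive definite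
      have hall : ∀ i, 0 < e i := by
        intro i; fin_cases i
        · exact h0
        · exact sign_eq_one_iff.1 (h01 ▸ sign_eq_one_iff.2 h0)
        · exact sign_eq_one_iff.1 (h12 ▸ h01 ▸ sign_eq_one_iff.2 h0)
      have hpd : J.PosDef := by
        rw [hJ]
        exact Matrix.posDef_diagonal_iff.2 fun i => Complex.zero_lt_real.2 (hall i)
      exact hz1 (norm_eq_one_of_isRoot_charpoly_of_mem_unitaryGroupOfForm_of_posDef hpd hγ hz)
  have hb : e (τ 0) * e (τ 2) < 0 := mul_apply_lineOf_neg he hind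
  refine ⟨hb, ?_⟩
  -- eigenframe
  obtain ⟨S, d, hS, hSd, hroots⟩ := Literature.LinearAlgebra.Matrix.exists_conj_eq_diagonal_of_nodup_roots' G (Polynomial.nodup_roots hsep)
  have hGS : G * S = S * Matrix.diagonal d := by
    have h : S * (S⁻¹ * G * S) = S * Matrix.diagonal d := congrArg (fun X => S * X) hSd
    rw [← Matrix.mul_assoc, Matrix.mul_nonsing_inv_cancel_left _ _ hS] at h
    exact h
  have hdinj : Function.Injective d := by
    have hnd : (Finset.univ.val.map d).Nodup := by rw [hroots]; exact Polynomial.nodup_roots hsep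
    exact (Multiset.nodup_map_iff_inj_on Finset.univ.nodup).1 hnd |> fun h i j hij => h i (Finset.mem_univ i) j (Finset.mem_univ j) hij
  have hdne : ∀ i, d i ≠ 0 := by
    have hdet : G.det * S.det = S.det * ∏ i, d i := by
      have h := congrArg Matrix.det hGS
      rwa [Matrix.det_mul, Matrix.det_mul, Matrix.det_diagonal] at h
    have hG0 : G.det ≠ 0 := ((Matrix.isUnit_iff_isUnit_det _).1 (Units.isUnit γ)).ne_zero
    intro i h0
    have : S.det * ∏ i, d i = 0 := by rw [Finset.prod_eq_zero (Finset.mem_univ i) h0, mul_zero]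
    rw [← hdet] at this
    exact (mul_ne_zero hG0 hS.ne_zero) this
  -- the non-unit eigenvalue is some `d i₀`
  obtain ⟨i₀, hi₀⟩ : ∃ i₀, d i₀ = z := by
    have hm : z ∈ Finset.univ.val.map d := by
      rw [hroots]; exact (Polynomial.mem_roots (Matrix.charpoly_monic G).ne_zero).2 hz
    obtain ⟨i₀, -, hi₀⟩ := Multiset.mem_map.1 hm
    exact ⟨i₀, hi₀⟩
  have hn0 : ‖d i₀‖ ≠ 1 := by rw [hi₀]; exact hz1
  -- frame relation, Hermitian Gram matrix
  set Q : Matrix (Fin 3) (Fin 3) ℂ := Sᴴ * J * S with hQ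
  have hrel : ∀ i j, ((starRingEnd ℂ) (d i) * d j - 1) * Q i j = 0 := fun i j => sub_one_mul_frameGram_apply_eq_zero_three hU hGS i j
  have hQherm : Qᴴ = Q := frameGram_conjTranspose S e
  have hQt : ∀ i j, Q j i = (starRingEnd ℂ) (Q i j) := fun i j => by
    have h := congrFun (congrFun hQherm j) i
    rw [Matrix.conjTranspose_apply] at h
    exact h.symm
  have hQdet : Q.det ≠ 0 := by
    rw [hQ, Matrix.det_mul, Matrix.det_mul, Matrix.det_conjTranspose, hJ, Matrix.det_diagonal]
    refine mul_ne_zero (mul_ne_zero ?_ ?_) hS.ne_zero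
    · rw [ne_eq, star_eq_zero]; exact hS.ne_zero
    · exact Finset.prod_ne_zero_iff.2 fun i _ => Complex.ofReal_ne_zero.2 (he i)
  have hnormsq : ∀ w : ℂ, (starRingEnd ℂ) w * w = ((‖w‖ : ℝ) : ℂ) ^ 2 := fun w => Complex.conj_mul' w
  have hnorm1 : ∀ i, (starRingEnd ℂ) (d i) * d i - 1 = 0 → ‖d i‖ = 1 := by
    intro i h
    rw [hnormsq, sub_eq_zero] at h
    have h1 : ‖d i‖ ^ 2 = 1 := by exact_mod_cast h
    exact (pow_eq_one_iff_of_nonneg (norm_nonneg _) two_ne_zero).1 h1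
  -- `Q i₀ i₀ = 0`
  have hQ00 : Q i₀ i₀ = 0 := by
    rcases mul_eq_zero.1 (hrel i₀ i₀) with h | h
    exacts [absurd (hnorm1 i₀ h) hn0, h]
  -- a nonzero entry `β = Q i₀ j` in the row `i₀`
  obtain ⟨j, hβ⟩ : ∃ j, Q i₀ j ≠ 0 := by
    by_contra hall
    push Not at hall
    exact hQdet (Matrix.det_eq_zero_of_row_eq_zero i₀ hall)
  have hji : j ≠ i₀ := fun h => hβ (by rw [h, hQ00])
  have hdj : (starRingEnd ℂ) (d i₀) * d j = 1 := by
    rcases mul_eq_zero.1 (hrel i₀ j) with h | h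
    exacts [sub_eq_zero.1 h, absurd h hβ]
  have hdj' : d j = ((starRingEnd ℂ) (d i₀))⁻¹ := eq_inv_of_mul_eq_one_right hdj
  -- the third index
  obtain ⟨m, hmi, hmj, hcover⟩ := exists_third_index i₀ j hji.symm
  have hQ0m : Q i₀ m = 0 := by
    rcases mul_eq_zero.1 (hrel i₀ m) with h | h
    · exfalso
      have : d m = d j := by rw [hdj']; exact eq_inv_of_mul_eq_one_right (sub_eq_zero.1 h)
      exact hmj (hdinj this)
    · exact h
  have hQm0 : Q m i₀ = 0 := by rw [hQt i₀ m, hQ0m, map_zero]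
  have hQjm : Q j m = 0 := by
    rcases mul_eq_zero.1 (hrel j m) with h | h
    · exfalso
      have hcj : (starRingEnd ℂ) (d j) = (d i₀)⁻¹ := by rw [hdj', map_inv₀, Complex.conj_conj]
      rw [hcj] at h
      have : d m = d i₀ := by
        have h2 : (d i₀)⁻¹ * d m = 1 := sub_eq_zero.1 h
        calc d m = d i₀ * ((d i₀)⁻¹ * d m) := by rw [← mul_assoc, mul_inv_cancel₀ (hdne i₀), one_mul]
          _ = d i₀ := by rw [h2, mul_one]
      exact hmi (hdinj this)
    · exact h
  have hQmj : Q m j = 0 := by rw [hQt j m, hQjm, map_zero]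
  have hQjj : Q j j = 0 := by
    rcases mul_eq_zero.1 (hrel j j) with h | h
    · exfalso
      have h2 := hnorm1 j h
      rw [hdj', norm_inv, Complex.norm_conj] at h2
      exact hn0 (inv_eq_one.1 h2)
    · exact h
  have hQmm : Q m m ≠ 0 := by
    intro h0
    apply hQdet
    refine Matrix.det_eq_zero_of_row_eq_zero m fun x => ?_
    rcases hcover x with hx | hx | hx <;> rw [hx]
    exacts [hQm0, hQmj, h0]
  have hdm1 : ‖d m‖ = 1 := by
    rcases mul_eq_zero.1 (hrel m m) with h | h
    exacts [hnorm1 m h, absurd h hQmm]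
  set q : ℝ := (Q m m).re with hq
  have hQmm' : Q m m = (q : ℂ) := by
    have him : (Q m m).im = 0 := Complex.conj_eq_iff_im.1 (hQt m m).symm
    exact Complex.ext (by simp [hq]) (by simp [him])
  have hq0 : q ≠ 0 := fun h => hQmm (by rw [hQmm', h, Complex.ofReal_zero])
  -- the permutation `ψ = (i₀, m, j)` and the explicit shape of `Q`
  obtain ⟨ψ, hψ0, hψ1, hψ2⟩ := exists_perm_apply_eq i₀ m j hmi.symm hji.symm hmj
  have hQψ : Q.submatrix ψ ψ = !![0, 0, Q i₀ j; 0, (q : ℂ), 0; (starRingEnd ℂ) (Q i₀ j), 0, 0] := by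
    ext a b'
    fin_cases a <;> fin_cases b' <;>
      simp [Matrix.submatrix_apply, hψ0, hψ1, hψ2, hQ00, hQ0m, hQm0, hQjm, hQmj, hQjj, hQmm', hQt i₀ j]
  -- determinant: `q |β|² = −|det S|² ∏ e`
  have hdetQ : Q.det = -((q : ℂ) * ((starRingEnd ℂ) (Q i₀ j) * Q i₀ j)) := by
    rw [← Matrix.det_submatrix_equiv_self ψ Q, hQψ, Matrix.det_fin_three]
    simp
    ring
  have hreal : q * ‖Q i₀ j‖ ^ 2 = -(‖S.det‖ ^ 2 * ∏ i, e i) := by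
    have h := hdetQ.symm.trans (det_frameGram S e)
    rw [hnormsq] at h
    have h' : (((-(q * ‖Q i₀ j‖ ^ 2)) : ℝ) : ℂ) = ((‖S.det‖ ^ 2 * ∏ i, e i : ℝ) : ℂ) := by
      rw [← h]; push_cast; ring
    have h'' := Complex.ofReal_injective h'
    linarith
  -- signs: `e (τ 1) / q > 0`
  have hprod : ∏ i, e i = e (τ 0) * e (τ 1) * e (τ 2) := by
    rw [← Equiv.prod_comp τ (fun i => e i), Fin.prod_univ_three]
  have hβpos : 0 < ‖Q i₀ j‖ ^ 2 := pow_pos (norm_pos_iff.2 hβ) 2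
  have hSpos : 0 < ‖S.det‖ ^ 2 := pow_pos (norm_pos_iff.2 hS.ne_zero) 2
  have he1sq : 0 < e (τ 1) ^ 2 := by rw [pow_two]; exact mul_self_pos.2 (he (τ 1))
  have hratio : 0 < e (τ 1) / q := by
    have h1 : 0 < e (τ 1) * q := by
      have h2 : e (τ 1) * q * ‖Q i₀ j‖ ^ 2 = -(‖S.det‖ ^ 2 * (e (τ 0) * e (τ 2))) * e (τ 1) ^ 2 := by
        rw [mul_assoc, hreal, hprod]; ring
      have h3 : 0 < -(‖S.det‖ ^ 2 * (e (τ 0) * e (τ 2))) * e (τ 1) ^ 2 := by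
        have h4 : 0 < -(‖S.det‖ ^ 2 * (e (τ 0) * e (τ 2))) := by nlinarith
        exact mul_pos h4 he1sq
      rw [← h2] at h3
      exact (mul_pos_iff_of_pos_right hβpos).1 h3
    have hq2 : 0 < q ^ 2 := by rw [pow_two]; exact mul_self_pos.2 hq0
    have h5 : e (τ 1) / q = (e (τ 1) * q) / q ^ 2 := by field_simp
    rw [h5]
    exact div_pos h1 hq2
  -- coordinates `(x, φ, θ)`
  set x : ℝ := Real.log ‖d i₀‖ with hx
  set θ : ℝ := Complex.arg (d i₀) with hθ
  set φ : ℝ := Complex.arg (d m) with hφ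
  have hx0 : x ≠ 0 := by
    intro h0
    have h := Real.exp_log (norm_pos_iff.2 (hdne i₀))
    rw [← hx, h0, Real.exp_zero] at h
    exact hn0 h.symm
  have e0 : Complex.exp ((x : ℂ) + (θ : ℂ) * I) = d i₀ := by
    rw [Complex.exp_add, ← Complex.ofReal_exp, Real.exp_log (norm_pos_iff.2 (hdne i₀))]
    exact Complex.norm_mul_exp_arg_mul_I (d i₀)
  have e1 : Complex.exp ((φ : ℂ) * I) = d m := by
    have h := Complex.norm_mul_exp_arg_mul_I (d m)
    rwa [hdm1, Complex.ofReal_one, one_mul] at h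
  have e2 : Complex.exp (-(x : ℂ) + (θ : ℂ) * I) = d j := by
    have hstar : (starRingEnd ℂ) (d i₀) = Complex.exp ((x : ℂ) - (θ : ℂ) * I) := by
      rw [← e0, ← Complex.exp_conj, map_add, map_mul, Complex.conj_ofReal, Complex.conj_ofReal, Complex.conj_I]
      ring_nf
    rw [hdj', hstar, ← Complex.exp_neg]
    congr 1
    ring
  have hEig : ∀ k, boostEig ![x, φ, θ] k = d (ψ k) := by
    intro k
    fin_cases k
    · simpa [boostEig, hψ0] using e0
    · simpa [boostEig, hψ1] using e1
    · simpa [boostEig, hψ2] using e2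
  -- the scalars
  set cm : ℝ := Real.sqrt (e (τ 1) / q) with hcm
  have hcm2 : ((cm : ℂ)) * (q : ℂ) * (cm : ℂ) = (e (τ 1) : ℂ) := by
    have h : cm * q * cm = e (τ 1) := by
      have hsq : cm * cm = e (τ 1) / q := by rw [hcm]; exact Real.mul_self_sqrt hratio.le
      calc cm * q * cm = (cm * cm) * q := by ring
        _ = e (τ 1) := by rw [hsq]; field_simp
    exact_mod_cast h
  have hcm0 : (cm : ℂ) ≠ 0 := Complex.ofReal_ne_zero.2 (Real.sqrt_pos.2 hratio).ne'
  set cj : ℂ := -2 * (e (τ 2) : ℂ) / Q i₀ j with hcj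
  have hcj0 : cj ≠ 0 := div_ne_zero (mul_ne_zero (by norm_num) (Complex.ofReal_ne_zero.2 (he _))) hβ
  have hcjβ : Q i₀ j * cj = -2 * (e (τ 2) : ℂ) := by rw [hcj]; field_simp
  have hjβ : (starRingEnd ℂ) cj * (starRingEnd ℂ) (Q i₀ j) = -2 * (e (τ 2) : ℂ) := by
    rw [← map_mul, mul_comm, hcjβ, map_mul, map_neg, Complex.conj_ofReal, map_ofNat]
  set cv : Fin 3 → ℂ := fun i => if i = i₀ then 1 else if i = m then (cm : ℂ) else cj with hcv
  have hcv0 : cv i₀ = 1 := by simp [hcv]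
  have hcvm : cv m = (cm : ℂ) := by simp [hcv, hmi]
  have hcvj : cv j = cj := by simp [hcv, hji, hmj.symm]
  have hcvne : ∀ i, cv i ≠ 0 := by
    intro i
    rcases hcover i with hx' | hx' | hx' <;> rw [hx']
    exacts [hcv0 ▸ one_ne_zero, hcvj ▸ hcj0, hcvm ▸ hcm0]
  -- the frame
  set X : Matrix (Fin 3) (Fin 3) ℂ := S * Matrix.diagonal cv with hX
  set σ : Equiv.Perm (Fin 3) := τ.symm.trans ψ with hσ
  set V : Matrix (Fin 3) (Fin 3) ℂ := X.submatrix id σ with hV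
  have hXdet : IsUnit X.det := by
    rw [hX, Matrix.det_mul, Matrix.det_diagonal]
    exact hS.mul (IsUnit.mk0 _ (Finset.prod_ne_zero_iff.2 fun i _ => hcvne i))
  have hVdet : IsUnit V.det := by
    rw [hV, Matrix.det_permute']
    exact (IsUnit.mk0 _ (by rw [Ne, Int.cast_eq_zero]; exact Units.ne_zero _)).mul hXdet
  have hGX : G * X = X * Matrix.diagonal d := by
    rw [hX, ← Matrix.mul_assoc, hGS, Matrix.mul_assoc, Matrix.mul_assoc, Matrix.diagonal_mul_diagonal, Matrix.diagonal_mul_diagonal]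
    congr 2; funext i; ring
  have hGV : G * V = V * Matrix.diagonal fun ℓ => d (σ ℓ) := by
    rw [hV, mul_submatrix_id, hGX, ← Matrix.submatrix_mul_equiv X (Matrix.diagonal d) id σ σ, Matrix.submatrix_diagonal_equiv]
    rfl
  -- the Gram matrix of the frame, in slot order `ψ`, is the model Gram matrix
  have hent : ∀ a b', (Xᴴ * J * X) a b' = (starRingEnd ℂ) (cv a) * Q a b' * cv b' := by
    intro a b'
    have h : Xᴴ * J * X = Matrix.diagonal (star cv) * Q * Matrix.diagonal cv := by
      rw [hX, Matrix.conjTranspose_mul, Matrix.diagonal_conjTranspose, hQ]; simp only [Matrix.mul_assoc]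
    rw [h, Matrix.mul_diagonal, Matrix.diagonal_mul]
    rfl
  have hK : (Xᴴ * J * X).submatrix ψ ψ = !![0, 0, -2 * (e (τ 2) : ℂ); 0, (e (τ 1) : ℂ), 0; -2 * (e (τ 2) : ℂ), 0, 0] := by
    ext a b'
    fin_cases a <;> fin_cases b' <;>
      simp [Matrix.submatrix_apply, hent, hψ0, hψ1, hψ2, hcv0, hcvm, hcvj, hQ00, hQ0m, hQm0, hQjm, hQmj, hQjj, hQmm', hQt i₀ j, hjβ, hcjβ, hcm2]
  -- the model frame and its Gram matrix
  have hPdet : IsUnit ((cayB (e ∘ τ)).submatrix τ.symm τ.symm).det := isUnit_det_cayB_submatrix τ e hb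
  have hJsub : J = (Matrix.diagonal fun k => ((e ∘ τ) k : ℂ)).submatrix τ.symm τ.symm := by
    rw [Matrix.submatrix_diagonal_equiv, hJ]
    congr 1; funext ℓ; simp
  have hPJP : ((cayB (e ∘ τ)).submatrix τ.symm τ.symm)ᴴ * J * (cayB (e ∘ τ)).submatrix τ.symm τ.symm =
      (!![0, 0, -2 * (e (τ 2) : ℂ); 0, (e (τ 1) : ℂ), 0; -2 * (e (τ 2) : ℂ), 0, 0] : Matrix (Fin 3) (Fin 3) ℂ).submatrix τ.symm τ.symm := by
    rw [Matrix.conjTranspose_submatrix, hJsub, Matrix.submatrix_mul_equiv, Matrix.submatrix_mul_equiv,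
      conjTranspose_cayB_mul_diagonal_mul_cayB (b := e ∘ τ) hb]
    rfl
  have hVJV : Vᴴ * J * V = ((cayB (e ∘ τ)).submatrix τ.symm τ.symm)ᴴ * J * (cayB (e ∘ τ)).submatrix τ.symm τ.symm := by
    rw [hV, conjTranspose_submatrix_mul_mul_submatrix, hPJP, ← hK, Matrix.submatrix_submatrix, hσ, Equiv.coe_trans]
  -- the model element
  have hD : (fun ℓ => boostEig ![x, φ, θ] (τ.symm ℓ)) = fun ℓ => d (σ ℓ) := by
    funext ℓ; rw [hEig, hσ, Equiv.trans_apply]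
  have hY : ((gprimeSplitGL τ e ![x, φ, θ] : GL (Fin 3) ℂ) : Matrix (Fin 3) (Fin 3) ℂ) =
      (cayB (e ∘ τ)).submatrix τ.symm τ.symm * Matrix.diagonal (fun ℓ => d (σ ℓ)) * ((cayB (e ∘ τ)).submatrix τ.symm τ.symm)⁻¹ := by
    rw [coe_gprimeSplitGL_eq_conj_diagonal τ e hb, hD]
  -- transport
  obtain ⟨hk1, hk2⟩ := frame_transport hVdet hPdet hGV hY hVJV
  have hkdet : IsUnit (V * ((cayB (e ∘ τ)).submatrix τ.symm τ.symm)⁻¹).det := by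
    rw [Matrix.det_mul]; exact hVdet.mul (Matrix.isUnit_nonsing_inv_det _ hPdet)
  refine ⟨Matrix.GeneralLinearGroup.mkOfDetNeZero _ hkdet.ne_zero, ?_, ![x, φ, θ], by simpa using hx0, ?_⟩
  · rw [mem_unitaryGroupOfForm_iff, transpose_map_starRingEnd_complex, Matrix.GeneralLinearGroup.val_mkOfDetNeZero]
    exact hk1
  · refine Matrix.GeneralLinearGroup.ext fun a b' => ?_
    rw [Units.val_mul, Units.val_mul, Matrix.coe_units_inv, Matrix.GeneralLinearGroup.val_mkOfDetNeZero, ← hk2]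

end Split

end Literature.NumberTheory.Automorphic.UnitaryGroup

end
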